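import Mathlib
import Literature.AlgebraicGeometry.Resolution.CobordantGame
import Literature.AlgebraicGeometry.Resolution.FormalCoordinateChange
import Summits.ResolutionOfSingularities.ResolutionOfSingularities.Theorems.WeightedInvariantLocalWeightedDropTerminalDoublePointsAux
import Summits.ResolutionOfSingularities.ResolutionOfSingularities.Theorems.WeightedInvariantLocalWeightedDropInsepPointStep
import Summits.ResolutionOfSingularities.ResolutionOfSingularities.Theorems.WeightedInvariantLocalWeightedDropInsepXChange

/-!
# `WeightedInvariant.LocalWeightedDrop`, line `hasse-ridge-face-selection`: the INSEP lift WITH A STATE (flag / history),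
# for Hauser–Wagner's flag-dependent height vector

Crux item stmt-ResolutionOfSingularities-8899 `LocalWeightedDrop` (route `ResolutionOfSingularities/WeightedInvariant`),
serving the door `WeightedConstruction` stmt-ResolutionOfSingularities-0571.  [OURS · L1 W4.3, chain w43, stub worker 3
(gen 2): the state-carrying form of the (u3) interface `insepWon_of_rankX` (p484591) for the piece S2iM
`stub_charTwoInseparableReductionWon` (SEAT TABLE v4: «∃κ w.r.t. TERM = Hauser–Wagner 2014 Thm 2(i)», whose adjusted height
vector `i_a(f, 𝓕)` depends on a FLAG `𝓕` transported along the blow-ups — a datum of the walk, not of the position);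
NOT a statement of any manuscript.]

`insepWon_of_stateRank` (characteristic `2`, `k` algebraically closed, one-variable singular germs won): states `s : S` (any
type), a rank `κ : S → k[[x₀,x₁]] → Ordinal`, an exit class `T`; the STEP PROPERTY: from every state and position
`(s, A₀)` (`ord A₀ > 2`) outside `T` the rank player names a cleaning `A₀ + φ²`, or a formal change `θ^* A₀` of the old
variables, or the point blow-up, or a permissible curve blow-up `V(x_i, y)` — and for every resulting (cleaned) position
`B` either `B ∈ T` or SOME new state `s'` with `κ s' B < κ s A₀`.  Then every `y² + A₀` with `ord A₀ > 2` is won (from every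
state).  `charTwoInseparableReductionWon_of_insepStateRank`: the v21–v26 stub S2iM VERBATIM from the existence of such
`(S, s₀, κ)` relative to the TERMINAL exit class over every algebraically closed field of characteristic `2`.
-/

set_option linter.dupNamespace false -- mandated namespace of this single-conjunct summit

namespace Summit.ResolutionOfSingularities.ResolutionOfSingularities.Theorems

open Literature.AlgebraicGeometry.Resolution
open Literature.AlgebraicGeometry.Resolution.CobordantGame

open InsepDoublePoint TerminalDoublePoint MvPowerSeries in
/-- THE INSEP LIFT WITH A STATE (characteristic `2`, `k` algebraically closed; one-variable singular germs won).  States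
`s : S`, rank `κ s A₀`, exit class `T`; step property with the four moves (cleaning, formal x-change, cleaned point blow-up,
cleaned curve blow-up), every resulting position in `T` or of smaller rank IN SOME NEW STATE.  Then `y² + A₀` is won for
every state `s` and every `A₀` with `ord A₀ > 2`. [OURS · L1 W4.3, (u3) interface, flag-carrying form] -/
theorem insepWon_of_stateRank (k : Type) [Field k] [CharP k 2] [IsAlgClosed k]
    (hlow : ∀ g : MvPowerSeries (Fin 1) k, CobordantGame.IsSingular k g → CobordantGame.Won k 1 g)
    (T : MvPowerSeries (Fin 2) k → Prop)
    (hT : ∀ A₀ : MvPowerSeries (Fin 2) k, T A₀ →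
      CobordantGame.Won k 3 (X (Fin.last 2) ^ 2 + rename (Fin.succAboveEmb (Fin.last 2)) A₀))
    {S : Type} (κ : S → MvPowerSeries (Fin 2) k → Ordinal.{0})
    (hstep : ∀ (s : S) (A₀ : MvPowerSeries (Fin 2) k), (2 : ℕ∞) < A₀.order → T A₀ ∨
      (∃ φ : MvPowerSeries (Fin 2) k, constantCoeff φ = 0 ∧ (2 : ℕ∞) < (A₀ + φ ^ 2).order ∧
        (T (A₀ + φ ^ 2) ∨ ∃ s' : S, κ s' (A₀ + φ ^ 2) < κ s A₀)) ∨
      (∃ θ : Fin 2 → MvPowerSeries (Fin 2) k, (∀ i, constantCoeff (θ i) = 0) ∧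
        IsUnit (Matrix.det (Matrix.of fun i j => coeff (Finsupp.single j 1) (θ i))) ∧
        (T (subst θ A₀) ∨ ∃ s' : S, κ s' (subst θ A₀) < κ s A₀)) ∨
      (∀ (c : Fin 2 → k) (i₀ : Fin 2), c i₀ ≠ 0 → ∀ (A' : MvPowerSeries (Fin 2) k) (α β : k),
        subst (fun l : Fin 2 => if l = i₀ then C (c i₀) * X 0 else
          X 0 * (C (c l) + (X 1 : MvPowerSeries (Fin 2) k))) A₀ = X 0 ^ 2 * A' →
        α ^ 2 = coeff (Finsupp.single 0 2) A' → β ^ 2 = coeff (Finsupp.single 1 2) A' →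
        (2 : ℕ∞) < (A' + (C α * X 0 + C β * X 1) ^ 2).order →
        T (A' + (C α * X 0 + C β * X 1) ^ 2) ∨ ∃ s' : S, κ s' (A' + (C α * X 0 + C β * X 1) ^ 2) < κ s A₀) ∨
      (∃ (i : Fin 2) (A₀' : MvPowerSeries (Fin 2) k), A₀ = X i ^ 2 * A₀' ∧ constantCoeff A₀' = 0 ∧
        ∀ c : k, c ≠ 0 → ∀ (A' : MvPowerSeries (Fin 2) k) (α β : k),
        A' = C (c ^ 2) * subst (fun l : Fin 2 => if l = i then C c * X 0 else (X 1 : MvPowerSeries (Fin 2) k)) A₀' →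
        α ^ 2 = coeff (Finsupp.single 0 2) A' → β ^ 2 = coeff (Finsupp.single 1 2) A' →
        (2 : ℕ∞) < (A' + (C α * X 0 + C β * X 1) ^ 2).order →
        T (A' + (C α * X 0 + C β * X 1) ^ 2) ∨ ∃ s' : S, κ s' (A' + (C α * X 0 + C β * X 1) ^ 2) < κ s A₀)) :
    ∀ (s : S) (A₀ : MvPowerSeries (Fin 2) k), (2 : ℕ∞) < A₀.order →
      CobordantGame.Won k 3 (X (Fin.last 2) ^ 2 + rename (Fin.succAboveEmb (Fin.last 2)) A₀) := by
  suffices key : ∀ (o : Ordinal.{0}) (s : S) (A₀ : MvPowerSeries (Fin 2) k), κ s A₀ = o → (2 : ℕ∞) < A₀.order →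
      Won k 3 (X (Fin.last 2) ^ 2 + rename (Fin.succAboveEmb (Fin.last 2)) A₀) from
    fun s A₀ h => key _ s A₀ rfl h
  intro o
  induction o using WellFoundedLT.induction with
  | ind o ih =>
  intro s A₀ ho hA₀
  have hres : ∀ B : MvPowerSeries (Fin 2) k, (2 : ℕ∞) < B.order → (T B ∨ ∃ s' : S, κ s' B < κ s A₀) →
      Won k 3 (X (Fin.last 2) ^ 2 + rename (Fin.succAboveEmb (Fin.last 2)) B) := by
    intro B hB hTB
    rcases hTB with hTB | ⟨s', hlt⟩
    · exact hT B hTB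
    · exact ih _ (ho ▸ hlt) s' B rfl hB
  rcases hstep s A₀ hA₀ with hTA | ⟨φ, hφ, hordφ, hresφ⟩ | ⟨θ, hθ0, hθdet, hresθ⟩ | hpoint | ⟨i, A₀', hdiv, h0, hcurve⟩
  · exact hT A₀ hTA
  · exact (won_dp_add_sq_iff φ hφ A₀).mp (hres _ hordφ hresφ)
  · exact (won_Xpow_add_xChange_iff 2 θ hθ0 hθdet A₀).mp (hres _ (two_lt_order_subst hθ0 hA₀) hresθ)
  · exact won_insep_of_pointStep k hlow A₀ hA₀ fun c i₀ hc A' α β hfac hα hβ hord =>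
      hres _ hord (hpoint c i₀ hc A' α β hfac hα hβ hord)
  · exact won_insep_of_curveStep k hlow i A₀ A₀' hdiv h0 fun c hc A' α β hA' hα hβ hord =>
      hres _ hord (hcurve c hc A' α β hA' hα hβ hord)

open InsepDoublePoint TerminalDoublePoint MvPowerSeries in
/-- S2iM FROM A STATE-CARRYING RANK (the v21–v26 stub `stub_charTwoInseparableReductionWon` VERBATIM as conclusion): if
over every algebraically closed field of characteristic `2` there are a state type `S` with an initial state `s₀` and a
rank `κ : S → k[[x₀,x₁]] → Ordinal` with the step property of `insepWon_of_stateRank` relative to the TERMINAL exit class,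
then — given the singular germs in `≤ 2` variables and the terminal double points — every `y² + A₀` with `ord A₀ > 2` is
won.  (For Hauser–Wagner: `S` = flags at the point, `κ` = the adjusted height vector in subordinate coordinates.)
[OURS · L1 W4.3] -/
theorem charTwoInseparableReductionWon_of_insepStateRank
    (hrank : ∀ (k : Type) [Field k] [CharP k 2] [IsAlgClosed k],
      ∃ (S : Type) (_ : S) (κ : S → MvPowerSeries (Fin 2) k → Ordinal.{0}),
      ∀ (s : S) (A₀ : MvPowerSeries (Fin 2) k), (2 : ℕ∞) < A₀.order →
      let T : MvPowerSeries (Fin 2) k → Prop := fun B => (2 : ℕ∞) < B.order ∧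
        ((∃ (r s : ℕ) (U : MvPowerSeries (Fin 2) k), constantCoeff U ≠ 0 ∧ ¬ (2 ∣ r ∧ 2 ∣ s) ∧
            B = X (0 : Fin 2) ^ r * X (1 : Fin 2) ^ s * U) ∨
          (∃ (i : Fin 2) (m : ℕ) (g : MvPowerSeries (Fin 2) k), 0 < m ∧ g.order = 1 ∧ B = X i ^ (2 * m) * g))
      T A₀ ∨
      (∃ φ : MvPowerSeries (Fin 2) k, constantCoeff φ = 0 ∧ (2 : ℕ∞) < (A₀ + φ ^ 2).order ∧
        (T (A₀ + φ ^ 2) ∨ ∃ s' : S, κ s' (A₀ + φ ^ 2) < κ s A₀)) ∨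
      (∃ θ : Fin 2 → MvPowerSeries (Fin 2) k, (∀ i, constantCoeff (θ i) = 0) ∧
        IsUnit (Matrix.det (Matrix.of fun i j => coeff (Finsupp.single j 1) (θ i))) ∧
        (T (subst θ A₀) ∨ ∃ s' : S, κ s' (subst θ A₀) < κ s A₀)) ∨
      (∀ (c : Fin 2 → k) (i₀ : Fin 2), c i₀ ≠ 0 → ∀ (A' : MvPowerSeries (Fin 2) k) (α β : k),
        subst (fun l : Fin 2 => if l = i₀ then C (c i₀) * X 0 else
          X 0 * (C (c l) + (X 1 : MvPowerSeries (Fin 2) k))) A₀ = X 0 ^ 2 * A' →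
        α ^ 2 = coeff (Finsupp.single 0 2) A' → β ^ 2 = coeff (Finsupp.single 1 2) A' →
        (2 : ℕ∞) < (A' + (C α * X 0 + C β * X 1) ^ 2).order →
        T (A' + (C α * X 0 + C β * X 1) ^ 2) ∨ ∃ s' : S, κ s' (A' + (C α * X 0 + C β * X 1) ^ 2) < κ s A₀) ∨
      (∃ (i : Fin 2) (A₀' : MvPowerSeries (Fin 2) k), A₀ = X i ^ 2 * A₀' ∧ constantCoeff A₀' = 0 ∧
        ∀ c : k, c ≠ 0 → ∀ (A' : MvPowerSeries (Fin 2) k) (α β : k),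
        A' = C (c ^ 2) * subst (fun l : Fin 2 => if l = i then C c * X 0 else (X 1 : MvPowerSeries (Fin 2) k)) A₀' →
        α ^ 2 = coeff (Finsupp.single 0 2) A' → β ^ 2 = coeff (Finsupp.single 1 2) A' →
        (2 : ℕ∞) < (A' + (C α * X 0 + C β * X 1) ^ 2).order →
        T (A' + (C α * X 0 + C β * X 1) ^ 2) ∨ ∃ s' : S, κ s' (A' + (C α * X 0 + C β * X 1) ^ 2) < κ s A₀)) :
    ∀ (k : Type) [Field k] [CharP k 2] [IsAlgClosed k],
      (∀ m : ℕ, m < 3 → ∀ g : MvPowerSeries (Fin m) k,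
        CobordantGame.IsSingular k g → CobordantGame.Won k m g) →
      (∀ (A₀ : MvPowerSeries (Fin 2) k), (2 : ℕ∞) < A₀.order →
        ((∃ (r s : ℕ) (U : MvPowerSeries (Fin 2) k), MvPowerSeries.constantCoeff U ≠ 0 ∧ ¬ (2 ∣ r ∧ 2 ∣ s) ∧
            A₀ = MvPowerSeries.X (0 : Fin 2) ^ r * MvPowerSeries.X (1 : Fin 2) ^ s * U) ∨
          (∃ (i : Fin 2) (m : ℕ) (g : MvPowerSeries (Fin 2) k), 0 < m ∧ g.order = 1 ∧
            A₀ = MvPowerSeries.X i ^ (2 * m) * g)) →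
        CobordantGame.Won k 3 (MvPowerSeries.X (Fin.last 2) ^ 2 +
          MvPowerSeries.rename (Fin.succAboveEmb (Fin.last 2)) A₀)) →
      ∀ (A₀ : MvPowerSeries (Fin 2) k), (2 : ℕ∞) < A₀.order →
        CobordantGame.Won k 3 (MvPowerSeries.X (Fin.last 2) ^ 2 +
          MvPowerSeries.rename (Fin.succAboveEmb (Fin.last 2)) A₀) := by
  intro k _ _ _ hlow hterm A₀ hA₀
  obtain ⟨S, s₀, κ, hκ⟩ := hrank k
  exact insepWon_of_stateRank k (hlow 1 (by norm_num)) _ (fun B hB => hterm B hB.1 hB.2) κ hκ s₀ A₀ hA₀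

end Summit.ResolutionOfSingularities.ResolutionOfSingularities.Theorems
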